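import Summits.RiemannHypothesis.RiemannHypothesis.Theses.LiAsymptotic
import Summits.RiemannHypothesis.RiemannHypothesis.Theorems.LiAsymptoticLiFarZeroTailCube
import Summits.RiemannHypothesis.RiemannHypothesis.Theorems.LiAsymptoticLiLowZerosTrivial
import Summits.RiemannHypothesis.RiemannHypothesis.Theorems.LiCoefficientsLiFarZeroTail
import Literature.NumberTheory.LFunctions.EquivalentsKeiperLiProofs
import HarnessLib

/-!
# RiemannHypothesis / LiAsymptotic — item `Assembly` (RH-FREE)

Route `RiemannHypothesis/LiAsymptotic` (cell `pub/rh-li`, D-0059/D-0061; rung L-P(P1⁺) «Li asymptotic law, quadratic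
range»): `Assembly := LiBoxTwoSided → LiSmoothMainTerm → LiOscillatoryS → LiAsymptoticBudget →
LiTheory.LiAsymptoticLawQuadratic`.  Proof = the theory seat's `assembly_of_supports` (rh-li-theory gen 5,
HOME/theory/route/p3/SketchAll.lean) fed by the two RH-free counting lemmas now in the tree:
`liFarZeroTailCube_bound` (`Σ_{T<γ≤U} m/γ³ ≤ log T/(4πT²)`, `LiAsymptoticLiFarZeroTailCube.lean`) and
`liLowZerosTrivial_bound` (`|2Σ_{γ≤a} m f_n(γ) − 2N₀(a)| ≤ 2N₀(a) + 4(0.3083 log a + 4.128)`,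
`LiAsymptoticLiLowZerosTrivial.lean`), plus the landed quartic tail `liFarZeroTail_bound`.  Bookkeeping:
`λ_n = lim_{T'} Re Σ_{liZeroBox T'}` (`keiperLiCoeff_eq_zero_sum_holds`); split the window sum at `√n`; add the
far-pair error (K1 + tails), the low count, the smooth main term (K2), the `S`-terms (K3); close with the budget (K4)
and pass to the limit `T' → ∞`.  RH-FREE [rh-li-prover]: the hypothesis is a FINITE verified height; nothing here
bears on the truth of RH.
-/

noncomputable section

-- D-0017: `Summit.<S>.<S>.…` is the designed namespace of a single-problem summit.
set_option linter.dupNamespace false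

open Filter Set MeasureTheory
open scoped Topology

namespace Summit.RiemannHypothesis.RiemannHypothesis.Theorems.LiTheory

open Literature.NumberTheory.LFunctions Literature.NumberTheory.LFunctions.SchoenfeldBound
open Literature.NumberTheory.DiophantineGeometry
open Summit.RiemannHypothesis.RiemannHypothesis.Theses.LiAsymptotic

/-- Splitting a window sum at an intermediate height (local copy for the assembly). -/
private theorem sum_zerosBetween_split_assembly {a b : ℝ} (ha : 0 ≤ a) (hab : a ≤ b) (g : ℂ → ℝ) :
    ∑ ρ ∈ zerosBetween 0 b, g ρ = (∑ ρ ∈ zerosBetween 0 a, g ρ) + ∑ ρ ∈ zerosBetween a b, g ρ := by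
  classical
  have hsub : zerosBetween 0 a ⊆ zerosBetween 0 b := by
    intro ρ hρ
    rw [mem_zerosBetween le_rfl] at hρ ⊢
    exact ⟨hρ.1, hρ.2.1, hρ.2.2.1, hρ.2.2.2.1, hρ.2.2.2.2.trans hab⟩
  have hsd : zerosBetween a b = zerosBetween 0 b \ zerosBetween 0 a := by
    ext ρ
    rw [Finset.mem_sdiff, mem_zerosBetween ha, mem_zerosBetween le_rfl, mem_zerosBetween le_rfl]
    constructor
    · rintro ⟨h0, h1, h2, h3, h4⟩
      exact ⟨⟨h0, h1, h2, by linarith, h4⟩, fun h ↦ by linarith [h.2.2.2.2]⟩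
    · rintro ⟨⟨h0, h1, h2, h3, h4⟩, hn⟩
      refine ⟨h0, h1, h2, ?_, h4⟩
      by_contra hle
      exact hn ⟨h0, h1, h2, h3, not_lt.1 hle⟩
  rw [hsd, ← Finset.sum_sdiff hsub, add_comm]

/-- **Item `Assembly` of route `LiAsymptotic` — PROVED** (the theory seat's composition from the two RH-free counting
lemmas `liFarZeroTailCube_bound`, `liLowZerosTrivial_bound` and the tree's `liFarZeroTail_bound`). -/
theorem liAsymptotic_assembly_proof : Summit.RiemannHypothesis.RiemannHypothesis.Theses.LiAsymptotic.Assembly := by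
  intro h1 h5 h6 h7 T hT hRH n hnc
  have h2 := liFarZeroTail_bound
  have h3 := liFarZeroTailCube_bound
  have h4 := liLowZerosTrivial_bound
  -- common data
  have hT4 : (4 : ℝ) ≤ T := by linarith
  have hnc' : (n : ℝ) ≤ T ^ 2 / 4 := by linarith
  have hπ := Real.pi_pos
  -- generic assembly: given a floor with √n ≥ 30 and an S-bound `ES` with budget, conclude
  have main : ∀ (ES : ℝ) (Cc : ℝ), 900 ≤ n →
      (∀ T' : ℝ, (n : ℝ) ^ 2 ≤ T' →
        |2 * (∑ ρ ∈ zerosBetween (Real.sqrt n) T', (riemannZetaZeroOrder ρ : ℝ) * liWindowWeight n ρ.im)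
          - 2 / Real.pi * (∫ t in Real.sqrt n..T', liWindowWeight n t * riemannSiegelThetaDeriv t)| ≤ ES) →
      liErrFar n T + liErrLow n + liErrSmooth n + ES ≤ Cc * Real.sqrt n * Real.log n →
      |keiperLiCoeff n - liMainTerm n| ≤ Cc * Real.sqrt n * Real.log n := by
    intro ES Cc hn900 hS hbudget
    have hn1 : 1 ≤ n := le_trans (by norm_num) hn900
    have hn100 : 100 ≤ n := le_trans (by norm_num) hn900
    have hnR : (900 : ℝ) ≤ n := by exact_mod_cast hn900
    have hsqrt30 : (30 : ℝ) ≤ Real.sqrt n := by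
      rw [show (30 : ℝ) = Real.sqrt 900 by rw [show (900 : ℝ) = 30 ^ 2 by norm_num, Real.sqrt_sq (by norm_num)]]
      exact Real.sqrt_le_sqrt hnR
    have hsqrt0 : (0 : ℝ) ≤ Real.sqrt n := Real.sqrt_nonneg _
    have hsqrt_le : Real.sqrt n ≤ (n : ℝ) ^ 2 := by
      have h1 : Real.sqrt n ≤ (n : ℝ) := by
        rw [Real.sqrt_le_left (by positivity)]
        nlinarith
      nlinarith
    -- pointwise bound for every large T'
    have hpt : ∀ T' : ℝ, max T ((n : ℝ) ^ 2) ≤ T' →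
        |(∑ᶠ ρ ∈ liZeroBox T', (riemannZetaZeroOrder ρ : ℂ) * (1 - (1 - 1 / ρ) ^ n)).re - liMainTerm n|
          ≤ Cc * Real.sqrt n * Real.log n := by
      intro T' hT'
      have hTT' : T ≤ T' := le_trans (le_max_left _ _) hT'
      have hnT' : (n : ℝ) ^ 2 ≤ T' := le_trans (le_max_right _ _) hT'
      have haT' : Real.sqrt n ≤ T' := hsqrt_le.trans hnT'
      -- K1 + tails
      have hbox := h1 n T T' hRH hT4 hTT' hnc'
      have ht4 := h2 T T' hT hTT'
      have ht3 := h3 T T' hT hTT'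
      have hfar : 2.82 * (n : ℝ) ^ 2 * (∑ ρ ∈ zerosBetween T T', (riemannZetaZeroOrder ρ : ℝ) / ρ.im ^ 4)
          + (n : ℝ) / 2 * (∑ ρ ∈ zerosBetween T T', (riemannZetaZeroOrder ρ : ℝ) / ρ.im ^ 3) ≤ liErrFar n T := by
        unfold liErrFar
        have hn0 : (0 : ℝ) ≤ n := by positivity
        have := mul_le_mul_of_nonneg_left ht4 (by positivity : (0 : ℝ) ≤ 2.82 * (n : ℝ) ^ 2)
        have := mul_le_mul_of_nonneg_left ht3 (by positivity : (0 : ℝ) ≤ (n : ℝ) / 2)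
        linarith
      -- split the window at √n
      have hsplit := sum_zerosBetween_split_assembly hsqrt0 haT'
        (fun ρ ↦ (riemannZetaZeroOrder ρ : ℝ) * liWindowWeight n ρ.im)
      -- LOW, SMOOTH, S
      have hlow := h4 n (Real.sqrt n) hsqrt30
      have hlow' : |2 * (∑ ρ ∈ zerosBetween 0 (Real.sqrt n), (riemannZetaZeroOrder ρ : ℝ) * liWindowWeight n ρ.im)
          - 2 * liCountMain (Real.sqrt n)| ≤ liErrLow n := by
        unfold liErrLow; exact hlow
      have hsm := h5 n T' hn100 hnT'
      have hSS := hS T' hnT'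
      -- triangle
      set B := (∑ᶠ ρ ∈ liZeroBox T', (riemannZetaZeroOrder ρ : ℂ) * (1 - (1 - 1 / ρ) ^ n)).re
      set W0 := ∑ ρ ∈ zerosBetween 0 (Real.sqrt n), (riemannZetaZeroOrder ρ : ℝ) * liWindowWeight n ρ.im
      set W1 := ∑ ρ ∈ zerosBetween (Real.sqrt n) T', (riemannZetaZeroOrder ρ : ℝ) * liWindowWeight n ρ.im
      set I := 2 / Real.pi * (∫ t in Real.sqrt n..T', liWindowWeight n t * riemannSiegelThetaDeriv t)
      set M := liMainTerm n
      set L := liCountMain (Real.sqrt n)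
      have hW : ∑ ρ ∈ zerosBetween 0 T', (riemannZetaZeroOrder ρ : ℝ) * liWindowWeight n ρ.im = W0 + W1 := hsplit
      rw [hW] at hbox
      have e1 := abs_le.1 (le_trans hbox hfar)
      have e2 := abs_le.1 hlow'
      have e3 := abs_le.1 hSS
      have e4 := abs_le.1 hsm
      rw [abs_le]
      constructor <;> linarith
    -- pass to the limit T' → ∞
    have hlim := keiperLiCoeff_eq_zero_sum_holds n hn1
    have hre : Tendsto (fun T' : ℝ ↦
        (∑ᶠ ρ ∈ liZeroBox T', (riemannZetaZeroOrder ρ : ℂ) * (1 - (1 - 1 / ρ) ^ n)).re) atTop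
        (𝓝 (keiperLiCoeff n)) := by
      have := (Complex.continuous_re.tendsto _).comp hlim
      simpa [Function.comp_def] using this
    have habs : Tendsto (fun T' : ℝ ↦
        |(∑ᶠ ρ ∈ liZeroBox T', (riemannZetaZeroOrder ρ : ℂ) * (1 - (1 - 1 / ρ) ^ n)).re - liMainTerm n|) atTop
        (𝓝 |keiperLiCoeff n - liMainTerm n|) :=
      (continuous_abs.tendsto _).comp (hre.sub_const _)
    exact le_of_tendsto habs (Filter.eventually_atTop.2 ⟨max T ((n : ℝ) ^ 2), hpt⟩)
  refine ⟨fun hn900 ↦ ?_, fun hn3 ↦ ?_⟩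
  · exact main (liErrOscPlain n) 2 hn900 (fun T' hT' ↦ ((h6 n T' hT').1 hn900)) ((h7 n T hT hnc).1 hn900)
  · have hn900 : 900 ≤ n := le_trans (by norm_num) hn3
    exact main (liErrOsc n) (1 / 3) hn900 (fun T' hT' ↦ ((h6 n T' hT').2 hn3)) ((h7 n T hT hnc).2 hn3)

end Summit.RiemannHypothesis.RiemannHypothesis.Theorems.LiTheory

end
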